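import Summits.BirchSwinnertonDyer.BirchSwinnertonDyer.Theorems.GenusKolyvaginAtTwoGenusPrimitiveSupplyAtTwoArchimedeanTransfer
import Summits.BirchSwinnertonDyer.BirchSwinnertonDyer.Theorems.GenusKolyvaginAtTwoGenusPrimitiveSupplyAtTwoArchimedeanKummerCard
import Summits.BirchSwinnertonDyer.BirchSwinnertonDyer.Theorems.GenusKolyvaginAtTwoGenusPrimitiveSupplyAtTwoTwistSelmerTransferUpRat
import HarnessLib

/-!
# Route `GenusKolyvaginAtTwo`, crux #2 `GenusPrimitiveSupplyAtTwo` (stmt-BirchSwinnertonDyer-22136):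
# Mazur–Rubin Cor. 3.4 (i) for the twist pair `(E, E^{(d)})` whose ONLY `T`-place is a REAL place — DOWN, UP and the
# T-A dichotomy from the place menu, modulo {PT, Tate χ[, Kramer parity]}, the transversality at `∞` DISPLAYED

Width seat `bsd-line-gk2-p5` g9 (cell `bsd-f1-sign2`, SUPPLY lineage, «UP general-K lane»), file 21 of the series (sequel of
`…ArchimedeanTransfer.lean` p633294 / `…ArchimedeanKummerCard.lean` / `…TwistSelmerTransferUpRat.lean` p630475 §35).
THEOREMS ONLY (no definition, no named fact, no `sorry`, no local instance); helper `--supports stmt-BirchSwinnertonDyer-22136`;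
no item is closed; BSD is not proved by any of this.

WHAT. The archimedean twins of §35 `GenusKolyTwistLocal.natCard_selmerGroup_twist_eq_mul_two_of_places_of_parity`: for `W/K`,
`Wd = C • W^{(d)}`, ONE intertwining identification `φ : Wd[2] ≅ W[2]` agreeing with the Kummer conditions at the places split in
`K(√d)` (`hsplit`, the shape produced by `exists_intertwining_hsplit`), a real place `w₀` with `w₀(Δ_W) > 0` (so `#𝓛_{w₀} = 2`,
`GenusKolyArch.natCard_kummerSelmerStructure_inl_eq_two_of_isReal`), every finite place on the MENU {split | odd & good for both |
odd & silent for both} and every other infinite place on the menu {split | `H¹ = 0` for both} (g8 `…TwistLocalConditionPlaces`,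
X11b `transport_kummer_inr_eq_of_good`), and the TRANSVERSALITY AT `w₀` of `φ_* 𝓛_{w₀}(Wd)` and `𝓛_{w₀}(W)` DISPLAYED (`htr` —
the one remaining local input, Kramer 1981 Prop. 6 / Mazur–Rubin Lemma 2.9 at `v ∣ ∞`; it holds for the canonical twist
identification and is `φ`-sensitive, see the crux memo `Lines/genus-supply-mr-instantiation.md` §6):

* §52 `natCard_selmerGroup_twist_mul_two_eq_of_places_inl` (DOWN, mod {PT, Tate χ}: a Selmer class of `W` with `loc_{w₀} ≠ 0` ⟹
  `#Sel₂(Wd)·2 = #Sel₂(W)`), `natCard_selmerGroup_twist_eq_mul_two_of_places_inl_of_parity` (UP, mod {PT, Tate χ, `kramerParity`},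
  `ρ̄_{W,2}` onto: `Sel₂(W)` strict at `w₀` ⟹ `#Sel₂(Wd) = #Sel₂(W)·2`), `natCard_selmerGroup_twist_shift_of_places_inl_of_parity`
  (the T-A DICHOTOMY `#Sel₂(Wd)·2 = #Sel₂(W) ∨ #Sel₂(Wd) = #Sel₂(W)·2`);
* §53 over `ℚ` (`0 < W.Δ`, one infinite place): `natCard_selmerGroup_twist_shift_rat_of_parity`, and for the SILENT prime Heegner twin
  (`d_K = −ℓ`, `#W(ℚ_ℓ)[2] = #Wd(ℚ_ℓ)[2] = 1`, Heegner for `N_W`, `2` split) `natCard_selmerGroup_silentTwin_shift_of_parity` — the cell's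
  T-A row `F1Sign2.AdmissibleTwistSelmerShiftAtTwo` on the habitat (`ρ̄₂` onto) modulo {PT, Tate χ, Kramer parity} AND `htr`.

References: [MazurRubin2010] Lemmas 2.9–2.11, Prop. 3.3, Cor. 3.4 (i), Thm. 2.7; [Kramer1981] §2 Prop. 6; [MilneADT2006] I Thm. 2.8,
2.13, 4.10, Rem. 3.7; [Howard2004HeegnerKolyvagin] Thm. 2.1.11.
-/

set_option linter.dupNamespace false -- tree convention: `Summit.BirchSwinnertonDyer.BirchSwinnertonDyer.Theorems` (summit = sub-problem)
set_option autoImplicit false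

noncomputable section

open scoped Classical ContRepresentation

namespace Summit.BirchSwinnertonDyer.BirchSwinnertonDyer.Theorems.GenusKolyArch

open WeierstrassCurve Field NumberField IsDedekindDomain Function
open Literature.NumberTheory.EllipticCurves Literature.NumberTheory.GaloisRepresentations
open Literature.NumberTheory.GaloisRepresentations.DiscreteGaloisModule (SelmerStructure)
open Literature.NumberTheory.GaloisCohomology
open Summit.BirchSwinnertonDyer.Rank1Residual.X11b.CongruentTransfer
open Summit.BirchSwinnertonDyer.BirchSwinnertonDyer.Theorems.GenusKolyTwistLocal
open Rat.HeightOneSpectrum (primesEquiv natGenerator)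

/-! ## §52 The twist pair with a single, REAL `T`-place: DOWN, UP, dichotomy from the place menu -/

section Places

variable {K : Type} [Field K] [NumberField K] (W : WeierstrassCurve K) [W.IsElliptic]

/-- The agreement `𝓐_v = 𝓚_{W,v}` at every place `v ≠ w₀` for the transported Kummer structure `𝓐 = φ_* 𝓚_{Wd}` of a twist
model, from the place menus (split: `hsplit`; odd good for both: X11b `transport_kummer_inr_eq_of_good`; odd silent for both and
`H¹ = 0` for both: g8 `…TwistLocalConditionPlaces`). [cite: MazurRubin2010, Lemma 2.10 (i), (ii), (iv), (v)] -/
theorem transport_twist_agree_off_inl {Wd : WeierstrassCurve K} [Wd.IsElliptic] {d : K}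
    (φ : (Wd.torsionGaloisModule ((2 : ℕ) : ℤ)).toContRepresentation →ⁱL
      (W.torsionGaloisModule ((2 : ℕ) : ℤ)).toContRepresentation)
    (ψ : (W.torsionGaloisModule ((2 : ℕ) : ℤ)).toContRepresentation →ⁱL
      (Wd.torsionGaloisModule ((2 : ℕ) : ℤ)).toContRepresentation)
    (hφψ : ∀ b, φ (ψ b) = b)
    (hsplit : ∀ (E : Type) [Field E] [Algebra K E], (∃ s : E, s ^ 2 = algebraMap K E d) →
      (Wd.kummerLocalConditionAt ((2 : ℕ) : ℤ) E).map (galoisCohomology.map (φ.restrictField E) 1) =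
        W.kummerLocalConditionAt ((2 : ℕ) : ℤ) E)
    (𝓐 : SelmerStructure (W.torsionGaloisModule ((2 : ℕ) : ℤ)))
    (h𝓐 : ∀ v, 𝓐 v = (Wd.kummerSelmerStructure ((2 : ℕ) : ℤ) v).map
      (galoisCohomology.map (φ.restrictField (Place.Completion v)) 1))
    (w₀ : InfinitePlace K)
    (hfin : ∀ v : HeightOneSpectrum (𝓞 K),
      (∃ s : v.adicCompletion K, s ^ 2 = algebraMap K (v.adicCompletion K) d) ∨
      (((2 : ℕ) : 𝓞 K) ∉ v.asIdeal ∧ W.HasGoodReductionAt v ∧ Wd.HasGoodReductionAt v) ∨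
      (((2 : ℕ) : 𝓞 K) ∉ v.asIdeal ∧
        Nat.card (nsmulAddMonoidHom 2 : (W.baseChange (v.adicCompletion K)).toAffine.Point →+ _).ker = 1 ∧
        Nat.card (nsmulAddMonoidHom 2 : (Wd.baseChange (v.adicCompletion K)).toAffine.Point →+ _).ker = 1))
    (hinf : ∀ w : InfinitePlace K, w ≠ w₀ →
      (∃ s : w.Completion, s ^ 2 = algebraMap K w.Completion d) ∨
      ((∀ x : galoisCohomology (W.localGaloisModule w.Completion) 1, x = 0) ∧
        (∀ x : galoisCohomology (Wd.localGaloisModule w.Completion) 1, x = 0))) :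
    ∀ v : Place K, v ≠ Sum.inl w₀ → 𝓐 v = W.kummerSelmerStructure ((2 : ℕ) : ℤ) v := by
  haveI : Fact (Nat.Prime 2) := ⟨Nat.prime_two⟩
  rintro (w | v) hv
  · have hww₀ : w ≠ w₀ := fun h ↦ hv (by rw [h])
    rcases hinf w hww₀ with ⟨s, hs⟩ | ⟨hW', hWd'⟩
    · rw [h𝓐, kummerSelmerStructure_apply, kummerSelmerStructure_apply]
      exact hsplit (Place.Completion (Sum.inl w)) ⟨s, hs⟩
    · rw [h𝓐, kummerSelmerStructure_apply, kummerSelmerStructure_apply]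
      exact map_kummerLocalConditionAt_eq_of_eq_top W Wd ((2 : ℕ) : ℤ) (Place.Completion (Sum.inl w)) φ ψ hφψ
        (kummerLocalConditionAt_eq_top_of_forall_eq_zero Wd _ _ hWd')
        (kummerLocalConditionAt_eq_top_of_forall_eq_zero W _ _ hW')
  · rcases hfin v with ⟨s, hs⟩ | ⟨h2v, hvW, hvWd⟩ | ⟨h2v, h1W, h1Wd⟩
    · rw [h𝓐, kummerSelmerStructure_apply, kummerSelmerStructure_apply]
      exact hsplit (Place.Completion (Sum.inr v)) ⟨s, hs⟩
    · exact transport_kummer_inr_eq_of_good W Wd 2 φ ψ hφψ 𝓐 h𝓐 h2v hvW hvWd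
    · rw [h𝓐, kummerSelmerStructure_apply, kummerSelmerStructure_apply]
      exact map_kummerLocalConditionAt_adicCompletion_eq_of_natCard_ker_eq_one W Wd v two_ne_zero h2v h1W h1Wd φ

/-- **Cor. 3.4 (i) DOWN with a single REAL `T`-place, from the place menu — kernel theorem modulo Poitou–Tate duality and Tate's
χ.** `W/K` elliptic, `Wd = C • W^{(d)}` elliptic, `φ, ψ` inverse intertwinings `Wd[2] ≅ W[2]` agreeing with the Kummer conditions
at split places, `w₀` a real place with `w₀(Δ_W) > 0`, every finite place and every infinite place `≠ w₀` on the menus, the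
transversality at `w₀` displayed: if some `c ∈ Sel₂(W)` has `loc_{w₀} c ≠ 0` then `#Sel₂(Wd) · 2 = #Sel₂(W)`.
[cite: MazurRubin2010, Prop. 3.3, Cor. 3.4 (i), Lemma 2.9] [cite: Kramer1981, §2 Prop. 6] [cite: MilneADT2006, I Thm. 2.13, 4.10] -/
theorem natCard_selmerGroup_twist_mul_two_eq_of_places_inl
    (hPT : poitouTate_selmerStructure_duality_real K)
    (hEP : ∀ v : HeightOneSpectrum (𝓞 K), localEulerPoincareCharacteristic (v.adicCompletion K))
    {Wd : WeierstrassCurve K} [Wd.IsElliptic] {d : K}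
    (φ : (Wd.torsionGaloisModule ((2 : ℕ) : ℤ)).toContRepresentation →ⁱL
      (W.torsionGaloisModule ((2 : ℕ) : ℤ)).toContRepresentation)
    (ψ : (W.torsionGaloisModule ((2 : ℕ) : ℤ)).toContRepresentation →ⁱL
      (Wd.torsionGaloisModule ((2 : ℕ) : ℤ)).toContRepresentation)
    (hψφ : ∀ a, ψ (φ a) = a) (hφψ : ∀ b, φ (ψ b) = b)
    (hsplit : ∀ (E : Type) [Field E] [Algebra K E], (∃ s : E, s ^ 2 = algebraMap K E d) →
      (Wd.kummerLocalConditionAt ((2 : ℕ) : ℤ) E).map (galoisCohomology.map (φ.restrictField E) 1) =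
        W.kummerLocalConditionAt ((2 : ℕ) : ℤ) E)
    {w₀ : InfinitePlace K} (hw₀ : w₀.IsReal) (hΔ : 0 < InfinitePlace.embedding_of_isReal hw₀ W.Δ)
    (hfin : ∀ v : HeightOneSpectrum (𝓞 K),
      (∃ s : v.adicCompletion K, s ^ 2 = algebraMap K (v.adicCompletion K) d) ∨
      (((2 : ℕ) : 𝓞 K) ∉ v.asIdeal ∧ W.HasGoodReductionAt v ∧ Wd.HasGoodReductionAt v) ∨
      (((2 : ℕ) : 𝓞 K) ∉ v.asIdeal ∧
        Nat.card (nsmulAddMonoidHom 2 : (W.baseChange (v.adicCompletion K)).toAffine.Point →+ _).ker = 1 ∧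
        Nat.card (nsmulAddMonoidHom 2 : (Wd.baseChange (v.adicCompletion K)).toAffine.Point →+ _).ker = 1))
    (hinf : ∀ w : InfinitePlace K, w ≠ w₀ →
      (∃ s : w.Completion, s ^ 2 = algebraMap K w.Completion d) ∨
      ((∀ x : galoisCohomology (W.localGaloisModule w.Completion) 1, x = 0) ∧
        (∀ x : galoisCohomology (Wd.localGaloisModule w.Completion) 1, x = 0)))
    (htr : (Wd.kummerLocalConditionAt ((2 : ℕ) : ℤ) w₀.Completion).map
        (galoisCohomology.map (φ.restrictField w₀.Completion) 1) ⊓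
      W.kummerLocalConditionAt ((2 : ℕ) : ℤ) w₀.Completion = ⊥)
    (hns : ∃ c ∈ (W.kummerSelmerStructure ((2 : ℕ) : ℤ)).selmerGroup,
      galoisCohomology.localization (W.torsionGaloisModule ((2 : ℕ) : ℤ)) (Sum.inl w₀) 1 c ≠ 0) :
    Nat.card (Wd.selmerGroup ((2 : ℕ) : ℤ)) * 2 = Nat.card (W.selmerGroup ((2 : ℕ) : ℤ)) := by
  haveI : Fact (Nat.Prime 2) := ⟨Nat.prime_two⟩
  let 𝓐 : SelmerStructure (W.torsionGaloisModule ((2 : ℕ) : ℤ)) := fun v ↦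
    (Wd.kummerSelmerStructure ((2 : ℕ) : ℤ) v).map (galoisCohomology.map (φ.restrictField (Place.Completion v)) 1)
  have h𝓐 : ∀ v, 𝓐 v = (Wd.kummerSelmerStructure ((2 : ℕ) : ℤ) v).map
      (galoisCohomology.map (φ.restrictField (Place.Completion v)) 1) := fun _ ↦ rfl
  have hagree := transport_twist_agree_off_inl W φ ψ hφψ hsplit 𝓐 h𝓐 w₀ hfin hinf
  have htr' : 𝓐 (Sum.inl w₀) ⊓ W.kummerSelmerStructure ((2 : ℕ) : ℤ) (Sum.inl w₀) = ⊥ := by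
    rw [h𝓐, kummerSelmerStructure_apply, kummerSelmerStructure_apply]
    exact htr
  exact natCard_selmerGroup_mul_eq_of_transverse_inl_of_localization_ne_zero W Wd 2 hPT hEP φ ψ hψφ hφψ 𝓐 h𝓐 w₀
    hagree htr' (natCard_kummerSelmerStructure_inl_eq_two_of_isReal W hw₀ hΔ) hns

/-- **Cor. 3.4 (i) UP with a single REAL `T`-place, from the place menu — kernel theorem modulo Poitou–Tate duality, Tate's χ and
Kramer's congruence (`MazurRubin2010.kramerParity`) BY NAME.** Same data, with `ρ̄_{W,2}` onto (so that `φ` is THE identification,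
`intertwining_apply_eq_of_hasSurjectiveModNGaloisRep_two`) and `d` a non-square in `K`: if `Sel₂(W)` is strict at `w₀` then
`#Sel₂(Wd) = #Sel₂(W) · 2`. [cite: MazurRubin2010, Thm. 2.7, Prop. 3.3, Cor. 3.4 (i), Lemma 2.9] [cite: Kramer1981, §2 Prop. 6, Thm. 1]
[cite: MilneADT2006, I Thm. 2.13, 4.10] -/
theorem natCard_selmerGroup_twist_eq_mul_two_of_places_inl_of_parity
    (hPT : poitouTate_selmerStructure_duality_real K)
    (hEP : ∀ v : HeightOneSpectrum (𝓞 K), localEulerPoincareCharacteristic (v.adicCompletion K))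
    (hKP : MazurRubin2010.kramerParity K) (hsurj : W.HasSurjectiveModNGaloisRep 2)
    {d : K} (hdsq : ∀ x : K, x ^ 2 ≠ d) {Wd : WeierstrassCurve K} [Wd.IsElliptic] {C : VariableChange K}
    (hWd : C • W.quadraticTwist d = Wd)
    (φ : (Wd.torsionGaloisModule ((2 : ℕ) : ℤ)).toContRepresentation →ⁱL
      (W.torsionGaloisModule ((2 : ℕ) : ℤ)).toContRepresentation)
    (ψ : (W.torsionGaloisModule ((2 : ℕ) : ℤ)).toContRepresentation →ⁱL
      (Wd.torsionGaloisModule ((2 : ℕ) : ℤ)).toContRepresentation)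
    (hψφ : ∀ a, ψ (φ a) = a) (hφψ : ∀ b, φ (ψ b) = b)
    (hsplit : ∀ (E : Type) [Field E] [Algebra K E], (∃ s : E, s ^ 2 = algebraMap K E d) →
      (Wd.kummerLocalConditionAt ((2 : ℕ) : ℤ) E).map (galoisCohomology.map (φ.restrictField E) 1) =
        W.kummerLocalConditionAt ((2 : ℕ) : ℤ) E)
    {w₀ : InfinitePlace K} (hw₀ : w₀.IsReal) (hΔ : 0 < InfinitePlace.embedding_of_isReal hw₀ W.Δ)
    (hfin : ∀ v : HeightOneSpectrum (𝓞 K),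
      (∃ s : v.adicCompletion K, s ^ 2 = algebraMap K (v.adicCompletion K) d) ∨
      (((2 : ℕ) : 𝓞 K) ∉ v.asIdeal ∧ W.HasGoodReductionAt v ∧ Wd.HasGoodReductionAt v) ∨
      (((2 : ℕ) : 𝓞 K) ∉ v.asIdeal ∧
        Nat.card (nsmulAddMonoidHom 2 : (W.baseChange (v.adicCompletion K)).toAffine.Point →+ _).ker = 1 ∧
        Nat.card (nsmulAddMonoidHom 2 : (Wd.baseChange (v.adicCompletion K)).toAffine.Point →+ _).ker = 1))
    (hinf : ∀ w : InfinitePlace K, w ≠ w₀ →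
      (∃ s : w.Completion, s ^ 2 = algebraMap K w.Completion d) ∨
      ((∀ x : galoisCohomology (W.localGaloisModule w.Completion) 1, x = 0) ∧
        (∀ x : galoisCohomology (Wd.localGaloisModule w.Completion) 1, x = 0)))
    (htr : (Wd.kummerLocalConditionAt ((2 : ℕ) : ℤ) w₀.Completion).map
        (galoisCohomology.map (φ.restrictField w₀.Completion) 1) ⊓
      W.kummerLocalConditionAt ((2 : ℕ) : ℤ) w₀.Completion = ⊥)
    (hstrict : ∀ c ∈ (W.kummerSelmerStructure ((2 : ℕ) : ℤ)).selmerGroup,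
      galoisCohomology.localization (W.torsionGaloisModule ((2 : ℕ) : ℤ)) (Sum.inl w₀) 1 c = 0) :
    Nat.card (Wd.selmerGroup ((2 : ℕ) : ℤ)) = Nat.card (W.selmerGroup ((2 : ℕ) : ℤ)) * 2 := by
  haveI : Fact (Nat.Prime 2) := ⟨Nat.prime_two⟩
  let 𝓐 : SelmerStructure (W.torsionGaloisModule ((2 : ℕ) : ℤ)) := fun v ↦
    (Wd.kummerSelmerStructure ((2 : ℕ) : ℤ) v).map (galoisCohomology.map (φ.restrictField (Place.Completion v)) 1)
  have h𝓐 : ∀ v, 𝓐 v = (Wd.kummerSelmerStructure ((2 : ℕ) : ℤ) v).map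
      (galoisCohomology.map (φ.restrictField (Place.Completion v)) 1) := fun _ ↦ rfl
  have hagree := transport_twist_agree_off_inl W φ ψ hφψ hsplit 𝓐 h𝓐 w₀ hfin hinf
  have htr' : 𝓐 (Sum.inl w₀) ⊓ W.kummerSelmerStructure ((2 : ℕ) : ℤ) (Sum.inl w₀) = ⊥ := by
    rw [h𝓐, kummerSelmerStructure_apply, kummerSelmerStructure_apply]
    exact htr
  -- the parity of the pair at `S = {w₀}`: Kramer's congruence, `φ` being THE identification (`ρ̄₂` onto)
  have hpar : IsSquare (Nat.card (Wd.selmerGroup ((2 : ℕ) : ℤ)) * Nat.card (W.selmerGroup ((2 : ℕ) : ℤ)) *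
      (𝓐 (Sum.inl w₀)).relIndex (W.kummerSelmerStructure ((2 : ℕ) : ℤ) (Sum.inl w₀))) := by
    have hS : ∀ v ∉ ({(Sum.inl w₀ : Place K)} : Finset (Place K)), 𝓐 v = W.kummerSelmerStructure ((2 : ℕ) : ℤ) v :=
      fun v hv ↦ hagree v (by simpa using hv)
    have h := hKP W d hdsq Wd ⟨C⁻¹, by rw [← hWd, inv_smul_smul]⟩ φ (Function.LeftInverse.injective hψφ)
      (intertwining_apply_eq_of_hasSurjectiveModNGaloisRep_two W Wd hsurj φ ψ hψφ hφψ) 𝓐 h𝓐 {(Sum.inl w₀ : Place K)} hS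
    rwa [Finset.prod_singleton] at h
  exact natCard_selmerGroup_eq_mul_of_transverse_inl_of_forall_localization_eq_zero W Wd 2 hPT hEP φ ψ hψφ hφψ 𝓐 h𝓐 w₀
    hagree htr' (natCard_kummerSelmerStructure_inl_eq_two_of_isReal W hw₀ hΔ) hstrict hpar

/-- **The T-A DICHOTOMY with a single REAL `T`-place** (UP or DOWN by exactly one `2`-dimension), from the place menu, modulo
{PT, Tate χ, Kramer parity}, `ρ̄_{W,2}` onto, the transversality at `w₀` displayed: `#Sel₂(Wd)·2 = #Sel₂(W)` (some Selmer class
of `W` is non-trivial at `w₀`) or `#Sel₂(Wd) = #Sel₂(W)·2` (`Sel₂(W)` strict at `w₀`).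
[cite: MazurRubin2010, Thm. 2.7, Prop. 3.3, Cor. 3.4 (i)] [cite: Kramer1981, §2 Prop. 6, Thm. 1] -/
theorem natCard_selmerGroup_twist_shift_of_places_inl_of_parity
    (hPT : poitouTate_selmerStructure_duality_real K)
    (hEP : ∀ v : HeightOneSpectrum (𝓞 K), localEulerPoincareCharacteristic (v.adicCompletion K))
    (hKP : MazurRubin2010.kramerParity K) (hsurj : W.HasSurjectiveModNGaloisRep 2)
    {d : K} (hdsq : ∀ x : K, x ^ 2 ≠ d) {Wd : WeierstrassCurve K} [Wd.IsElliptic] {C : VariableChange K}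
    (hWd : C • W.quadraticTwist d = Wd)
    (φ : (Wd.torsionGaloisModule ((2 : ℕ) : ℤ)).toContRepresentation →ⁱL
      (W.torsionGaloisModule ((2 : ℕ) : ℤ)).toContRepresentation)
    (ψ : (W.torsionGaloisModule ((2 : ℕ) : ℤ)).toContRepresentation →ⁱL
      (Wd.torsionGaloisModule ((2 : ℕ) : ℤ)).toContRepresentation)
    (hψφ : ∀ a, ψ (φ a) = a) (hφψ : ∀ b, φ (ψ b) = b)
    (hsplit : ∀ (E : Type) [Field E] [Algebra K E], (∃ s : E, s ^ 2 = algebraMap K E d) →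
      (Wd.kummerLocalConditionAt ((2 : ℕ) : ℤ) E).map (galoisCohomology.map (φ.restrictField E) 1) =
        W.kummerLocalConditionAt ((2 : ℕ) : ℤ) E)
    {w₀ : InfinitePlace K} (hw₀ : w₀.IsReal) (hΔ : 0 < InfinitePlace.embedding_of_isReal hw₀ W.Δ)
    (hfin : ∀ v : HeightOneSpectrum (𝓞 K),
      (∃ s : v.adicCompletion K, s ^ 2 = algebraMap K (v.adicCompletion K) d) ∨
      (((2 : ℕ) : 𝓞 K) ∉ v.asIdeal ∧ W.HasGoodReductionAt v ∧ Wd.HasGoodReductionAt v) ∨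
      (((2 : ℕ) : 𝓞 K) ∉ v.asIdeal ∧
        Nat.card (nsmulAddMonoidHom 2 : (W.baseChange (v.adicCompletion K)).toAffine.Point →+ _).ker = 1 ∧
        Nat.card (nsmulAddMonoidHom 2 : (Wd.baseChange (v.adicCompletion K)).toAffine.Point →+ _).ker = 1))
    (hinf : ∀ w : InfinitePlace K, w ≠ w₀ →
      (∃ s : w.Completion, s ^ 2 = algebraMap K w.Completion d) ∨
      ((∀ x : galoisCohomology (W.localGaloisModule w.Completion) 1, x = 0) ∧
        (∀ x : galoisCohomology (Wd.localGaloisModule w.Completion) 1, x = 0)))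
    (htr : (Wd.kummerLocalConditionAt ((2 : ℕ) : ℤ) w₀.Completion).map
        (galoisCohomology.map (φ.restrictField w₀.Completion) 1) ⊓
      W.kummerLocalConditionAt ((2 : ℕ) : ℤ) w₀.Completion = ⊥) :
    Nat.card (Wd.selmerGroup ((2 : ℕ) : ℤ)) * 2 = Nat.card (W.selmerGroup ((2 : ℕ) : ℤ)) ∨
      Nat.card (Wd.selmerGroup ((2 : ℕ) : ℤ)) = Nat.card (W.selmerGroup ((2 : ℕ) : ℤ)) * 2 := by
  by_cases hstrict : ∀ c ∈ (W.kummerSelmerStructure ((2 : ℕ) : ℤ)).selmerGroup,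
      galoisCohomology.localization (W.torsionGaloisModule ((2 : ℕ) : ℤ)) (Sum.inl w₀) 1 c = 0
  · exact Or.inr (natCard_selmerGroup_twist_eq_mul_two_of_places_inl_of_parity W hPT hEP hKP hsurj hdsq hWd φ ψ hψφ hφψ
      hsplit hw₀ hΔ hfin hinf htr hstrict)
  · push Not at hstrict
    obtain ⟨c, hc, hne⟩ := hstrict
    exact Or.inl (natCard_selmerGroup_twist_mul_two_eq_of_places_inl W hPT hEP φ ψ hψφ hφψ hsplit hw₀ hΔ hfin hinf htr
      ⟨c, hc, hne⟩)

end Places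

/-! ## §53 Over `ℚ`: `Δ_W > 0`, one infinite place -/

section Rat

variable (W : WeierstrassCurve ℚ) [W.IsElliptic]

/-- **The T-A dichotomy over `ℚ` for `Δ_W > 0`** — modulo {PT, Tate χ, Kramer parity}, `ρ̄_{W,2}` onto, finite places on the menu,
the transversality at `∞` of `φ_* 𝓛_∞(Wd)` and `𝓛_∞(W)` displayed (`ℚ` has one infinite place, so no other archimedean
hypothesis). [cite: MazurRubin2010, Thm. 2.7, Prop. 3.3, Cor. 3.4 (i)] [cite: Kramer1981, §2 Prop. 6, Thm. 1] -/
theorem natCard_selmerGroup_twist_shift_rat_of_parity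
    (hPT : poitouTate_selmerStructure_duality_real ℚ)
    (hEP : ∀ v : HeightOneSpectrum (𝓞 ℚ), localEulerPoincareCharacteristic (v.adicCompletion ℚ))
    (hKP : MazurRubin2010.kramerParity ℚ) (hsurj : W.HasSurjectiveModNGaloisRep 2) (hΔ : 0 < W.Δ)
    {d : ℚ} (hdsq : ∀ x : ℚ, x ^ 2 ≠ d) {Wd : WeierstrassCurve ℚ} [Wd.IsElliptic] {C : VariableChange ℚ}
    (hWd : C • W.quadraticTwist d = Wd)
    (φ : (Wd.torsionGaloisModule ((2 : ℕ) : ℤ)).toContRepresentation →ⁱL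
      (W.torsionGaloisModule ((2 : ℕ) : ℤ)).toContRepresentation)
    (ψ : (W.torsionGaloisModule ((2 : ℕ) : ℤ)).toContRepresentation →ⁱL
      (Wd.torsionGaloisModule ((2 : ℕ) : ℤ)).toContRepresentation)
    (hψφ : ∀ a, ψ (φ a) = a) (hφψ : ∀ b, φ (ψ b) = b)
    (hsplit : ∀ (E : Type) [Field E] [Algebra ℚ E], (∃ s : E, s ^ 2 = algebraMap ℚ E d) →
      (Wd.kummerLocalConditionAt ((2 : ℕ) : ℤ) E).map (galoisCohomology.map (φ.restrictField E) 1) =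
        W.kummerLocalConditionAt ((2 : ℕ) : ℤ) E)
    (w₀ : InfinitePlace ℚ)
    (hfin : ∀ v : HeightOneSpectrum (𝓞 ℚ),
      (∃ s : v.adicCompletion ℚ, s ^ 2 = algebraMap ℚ (v.adicCompletion ℚ) d) ∨
      (((2 : ℕ) : 𝓞 ℚ) ∉ v.asIdeal ∧ W.HasGoodReductionAt v ∧ Wd.HasGoodReductionAt v) ∨
      (((2 : ℕ) : 𝓞 ℚ) ∉ v.asIdeal ∧
        Nat.card (nsmulAddMonoidHom 2 : (W.baseChange (v.adicCompletion ℚ)).toAffine.Point →+ _).ker = 1 ∧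
        Nat.card (nsmulAddMonoidHom 2 : (Wd.baseChange (v.adicCompletion ℚ)).toAffine.Point →+ _).ker = 1))
    (htr : (Wd.kummerLocalConditionAt ((2 : ℕ) : ℤ) w₀.Completion).map
        (galoisCohomology.map (φ.restrictField w₀.Completion) 1) ⊓
      W.kummerLocalConditionAt ((2 : ℕ) : ℤ) w₀.Completion = ⊥) :
    Nat.card (Wd.selmerGroup 2) * 2 = Nat.card (W.selmerGroup 2) ∨
      Nat.card (Wd.selmerGroup 2) = Nat.card (W.selmerGroup 2) * 2 := by
  have hw₀ : w₀.IsReal := by rw [Subsingleton.elim w₀ Rat.infinitePlace]; exact Rat.isReal_infinitePlace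
  have hΔ' : 0 < InfinitePlace.embedding_of_isReal hw₀ W.Δ := by rwa [embedding_of_isReal_rat_apply, Rat.cast_pos]
  have hinf : ∀ w : InfinitePlace ℚ, w ≠ w₀ →
      (∃ s : w.Completion, s ^ 2 = algebraMap ℚ w.Completion d) ∨
      ((∀ x : galoisCohomology (W.localGaloisModule w.Completion) 1, x = 0) ∧
        (∀ x : galoisCohomology (Wd.localGaloisModule w.Completion) 1, x = 0)) :=
    fun w hw ↦ absurd (Subsingleton.elim w w₀) hw
  exact natCard_selmerGroup_twist_shift_of_places_inl_of_parity W hPT hEP hKP hsurj hdsq hWd φ ψ hψφ hφψ hsplit hw₀ hΔ'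
    hfin hinf htr

/-- **The SILENT prime Heegner twin on `Δ_W > 0` — the cell's T-A row on the habitat, modulo {PT, Tate χ, Kramer parity} and the
transversality at `∞`.** `W/ℚ` globally minimal elliptic with `ρ̄_{W,2}` onto and `Δ_W > 0`; `K` imaginary quadratic with `d_K = −ℓ`
odd (`ℓ` prime), Heegner for `N_W`, `2` split in `K`; `ℓ` SILENT for `W` and for the twist model `Wd` of `W^{(d_K)}`
(`#W(ℚ_ℓ)[2] = #Wd(ℚ_ℓ)[2] = 1`, displayed); `φ, ψ` inverse intertwinings `Wd[2] ≅ W[2]` agreeing with the Kummer conditions at split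
places and TRANSVERSE AT `∞` (displayed): then `#Sel₂(Wd)·2 = #Sel₂(W)` or `#Sel₂(Wd) = #Sel₂(W)·2` — same currency as §36
`GenusKolyTwistLocal.natCard_selmerGroup_twin_eq_two_mul_of_le_strictLocalKer_of_parity` (the `Δ_W < 0` twin, `T = {ℓ}`).
[cite: MazurRubin2010, Thm. 2.7, Prop. 3.3, Cor. 3.4 (i), Lemma 2.10] [cite: Kramer1981, §2 Prop. 6, Thm. 1] [cite: GrossLMS1991, §1 (p. 235)] -/
theorem natCard_selmerGroup_silentTwin_shift_of_parity [W.IsGloballyMinimal] {K : Type} [Field K] [NumberField K]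
    (hPT : poitouTate_selmerStructure_duality_real ℚ)
    (hEP : ∀ v : HeightOneSpectrum (𝓞 ℚ), localEulerPoincareCharacteristic (v.adicCompletion ℚ))
    (hKP : MazurRubin2010.kramerParity ℚ) (hsurj : W.HasSurjectiveModNGaloisRep 2) (hΔ : 0 < W.Δ)
    (hK : IsImaginaryQuadratic K) (hodd : Odd (discr K)) (hH : SatisfiesHeegnerHypothesis (W.conductorNorm ℤ) K)
    (h2K : ((Ideal.span {(2 : ℤ)}).primesOver (𝓞 K)).ncard = 2)
    {ℓ : ℕ} [Fact ℓ.Prime] (hd : discr K = -(ℓ : ℤ)) {Wd : WeierstrassCurve ℚ} [Wd.IsElliptic]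
    (hWd : ∃ C : VariableChange ℚ, C • W.quadraticTwist (discr K : ℚ) = Wd)
    (hℓW : Nat.card (nsmulAddMonoidHom 2 : (W.baseChange ℚ_[ℓ]).toAffine.Point →+ _).ker = 1)
    (hℓWd : Nat.card (nsmulAddMonoidHom 2 : (Wd.baseChange ℚ_[ℓ]).toAffine.Point →+ _).ker = 1)
    (φ : (Wd.torsionGaloisModule ((2 : ℕ) : ℤ)).toContRepresentation →ⁱL
      (W.torsionGaloisModule ((2 : ℕ) : ℤ)).toContRepresentation)
    (ψ : (W.torsionGaloisModule ((2 : ℕ) : ℤ)).toContRepresentation →ⁱL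
      (Wd.torsionGaloisModule ((2 : ℕ) : ℤ)).toContRepresentation)
    (hψφ : ∀ a, ψ (φ a) = a) (hφψ : ∀ b, φ (ψ b) = b)
    (hsplit : ∀ (E : Type) [Field E] [Algebra ℚ E], (∃ s : E, s ^ 2 = algebraMap ℚ E (discr K : ℚ)) →
      (Wd.kummerLocalConditionAt ((2 : ℕ) : ℤ) E).map (galoisCohomology.map (φ.restrictField E) 1) =
        W.kummerLocalConditionAt ((2 : ℕ) : ℤ) E)
    (w₀ : InfinitePlace ℚ)
    (htr : (Wd.kummerLocalConditionAt ((2 : ℕ) : ℤ) w₀.Completion).map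
        (galoisCohomology.map (φ.restrictField w₀.Completion) 1) ⊓
      W.kummerLocalConditionAt ((2 : ℕ) : ℤ) w₀.Completion = ⊥) :
    Nat.card (Wd.selmerGroup 2) * 2 = Nat.card (W.selmerGroup 2) ∨
      Nat.card (Wd.selmerGroup 2) = Nat.card (W.selmerGroup 2) * 2 := by
  have hℓ : ℓ.Prime := Fact.out
  obtain ⟨hℓ2, -, -⟩ := GenusKolyTwin.prime_discr_facts W hK hodd hH hℓ hd
  obtain ⟨C, hC⟩ := hWd
  -- the place `v₀` of `ℚ` over `ℓ`
  obtain ⟨v₀, hv₀⟩ : ∃ v : HeightOneSpectrum (𝓞 ℚ), ((primesEquiv v : Nat.Primes) : ℕ) = ℓ :=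
    ⟨primesEquiv.symm ⟨ℓ, hℓ⟩, by rw [Equiv.apply_symm_apply]⟩
  have hℓv₀ : (ℓ : 𝓞 ℚ) ∈ v₀.asIdeal := by
    rw [← hv₀]
    exact Rat.HeightOneSpectrum.natCast_natGenerator_mem v₀
  have h2v₀ : ((2 : ℕ) : 𝓞 ℚ) ∉ v₀.asIdeal :=
    GenusKolyTwistingPrime.natCast_not_mem_of_not_dvd hℓ hℓv₀ fun h ↦
      hℓ2 ((Nat.prime_dvd_prime_iff_eq hℓ Nat.prime_two).mp h)
  have hmenu := twist_place_menu_finite_rat W hK.1 hH h2K hℓ hd hℓv₀ hC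
  refine natCard_selmerGroup_twist_shift_rat_of_parity W hPT hEP hKP hsurj hΔ (forall_sq_ne_discr_of_discr_eq_neg hℓ hd) hC
    φ ψ hψφ hφψ hsplit w₀ (fun v ↦ ?_) htr
  by_cases hv : v = v₀
  · subst hv
    refine Or.inr (Or.inr ⟨h2v₀, ?_, ?_⟩)
    · rw [natCard_ker_nsmul_adicCompletion_eq_padic W v 2]
      subst hv₀
      exact hℓW
    · rw [natCard_ker_nsmul_adicCompletion_eq_padic Wd v 2]
      subst hv₀
      exact hℓWd
  · exact hmenu v hv

end Rat

end Summit.BirchSwinnertonDyer.BirchSwinnertonDyer.Theorems.GenusKolyArch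

end
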